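import Mathlib
import Summits.NavierStokesRegularity.NavierStokesRegularity.Theorems.EulerZoomLiouvillePowerGaugeEulerLiouvilleSelfSimilarBernoulliLandscape
import HarnessLib

/-!
# Crux `EulerZoomLiouville.PowerGaugeEulerLiouville` (stmt-NavierStokesRegularity-19832): NO FOCUSING — plate t59-NF of nsreg-p2 ROUND-54 «THE TRACE»

Width/portrait piece for THE ONE STATEMENT `stub_selfSimilarC2Needle` (LEAD skeleton `Cruxes/PowerGaugeEulerLiouville/Lines/birth.lean` v111,
ns-typeII-p2 g16), `--supports stmt-NavierStokesRegularity-19832 --as helper`.  Text = nsreg-p2 g44's `NsregP2.R54.Trace.NoFocusingLaw ρ V`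
(`r54/Sketch54.lean` sha16 f78682d2f4ee3f27) VERBATIM with `simFlow` unfolded.

For a `C²` self-similar Euler profile `(V, P)` with exponent `γ = 1/(2+ρ)` (`ρ > −2`), centre `0`, and the lineage's cut-off idiom
(a `C²` copy `V′` with `‖DV′‖ ≤ K`, `V′ = V` on `ball 0 Rbig`, flow `Ψ_s = ODE.evolutionMap (fun _ => selfSimilarTransport γ 0 V′) 0 s`):
the labels `y ∈ B_L` whose trajectory stays in the `CL`-tube (`‖Ψ_σ y‖ ≤ CL·e^{γσ}`, `σ ∈ [0,S]`) and sits at PHYSICAL radius `≤ δ` at the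
horizon (`‖Ψ_S y‖ ≤ δe^{γS}`) have volume `≤ vol B̄_δ`.  Proof: the label set `Y` is closed ∩ ball, its orbits stay in the closed ball of radius
`CLe^{γS} < Rbig` where `V′ = V` is divergence-free, so `vol(Ψ_S Y) = e^{3γS}·vol Y` (`BernoulliLandscape.volume_image_flow_eq_exp_of_stay`);
and `Ψ_S Y ⊆ B̄(0, δe^{γS})`, of volume `e^{3γS}·vol B̄_δ` (Haar scaling).  Reading (R54 §C): at every fixed physical time the particles starting in
a ball do not focus onto the singular point, in measure — pure incompressibility.

HONEST FRAMING: a portrait instrument about HYPOTHETICAL profiles; nothing about the crux E (19832 OPEN) or NS regularity is proved.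
[nsreg-p2 R54 §C t59-NF; cite: ConstantinIgnatovaVicol2026Putative, §3.4.1 eq. (3.22)]
-/

noncomputable section

set_option linter.dupNamespace false

open MeasureTheory Set Filter Topology Metric Function
open scoped RealInnerProductSpace NNReal ENNReal ContDiff

namespace Summit.NavierStokesRegularity.NavierStokesRegularity.Theorems.PowerGaugeEulerLiouville.Trace

open Literature.Analysis Literature.Analysis.FluidPDE
open Summit.NavierStokesRegularity.NavierStokesRegularity.Theorems.PowerGaugeEulerLiouville.BernoulliLandscape

/-- **The tube-and-target label set is measurable**: for a `C²` field `V′` with bounded derivative, the set of `y ∈ ball 0 L` whose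
flow trajectory satisfies `‖Ψ_σ y‖ ≤ f σ` for all `σ ∈ [0,S]` and `‖Ψ_S y‖ ≤ d` is the intersection of an open ball with a closed set.
[folklore] -/
theorem measurableSet_tubeLabels {γ : ℝ} {V' : EuclideanSpace ℝ (Fin 3) → EuclideanSpace ℝ (Fin 3)} (hV' : ContDiff ℝ 2 V')
    {K : ℝ} (hK : ∀ y, ‖fderiv ℝ V' y‖ ≤ K) (L S d : ℝ) (f : ℝ → ℝ) :
    MeasurableSet {y ∈ ball (0 : EuclideanSpace ℝ (Fin 3)) L |
      (∀ σ ∈ Icc 0 S, ‖ODE.evolutionMap (fun _ : ℝ => selfSimilarTransport γ 0 V') 0 σ y‖ ≤ f σ) ∧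
        ‖ODE.evolutionMap (fun _ : ℝ => selfSimilarTransport γ 0 V') 0 S y‖ ≤ d} := by
  have hcont : ∀ σ : ℝ, Continuous (ODE.evolutionMap (fun _ : ℝ => selfSimilarTransport γ 0 V') 0 σ) := fun σ =>
    (C2.Kelvin.contDiff_flow (γ := γ) hV' hK σ).continuous
  have h1 : IsClosed {y : EuclideanSpace ℝ (Fin 3) |
      ∀ σ ∈ Icc 0 S, ‖ODE.evolutionMap (fun _ : ℝ => selfSimilarTransport γ 0 V') 0 σ y‖ ≤ f σ} := by
    have : {y : EuclideanSpace ℝ (Fin 3) |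
        ∀ σ ∈ Icc 0 S, ‖ODE.evolutionMap (fun _ : ℝ => selfSimilarTransport γ 0 V') 0 σ y‖ ≤ f σ} =
        ⋂ σ ∈ Icc 0 S, {y | ‖ODE.evolutionMap (fun _ : ℝ => selfSimilarTransport γ 0 V') 0 σ y‖ ≤ f σ} := by
      ext y; simp only [mem_setOf_eq, mem_iInter]
    rw [this]
    exact isClosed_biInter fun σ _ => isClosed_le ((hcont σ).norm) continuous_const
  have h2 : IsClosed {y : EuclideanSpace ℝ (Fin 3) |
      ‖ODE.evolutionMap (fun _ : ℝ => selfSimilarTransport γ 0 V') 0 S y‖ ≤ d} :=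
    isClosed_le ((hcont S).norm) continuous_const
  have hset : {y ∈ ball (0 : EuclideanSpace ℝ (Fin 3)) L |
      (∀ σ ∈ Icc 0 S, ‖ODE.evolutionMap (fun _ : ℝ => selfSimilarTransport γ 0 V') 0 σ y‖ ≤ f σ) ∧
        ‖ODE.evolutionMap (fun _ : ℝ => selfSimilarTransport γ 0 V') 0 S y‖ ≤ d} =
      ball (0 : EuclideanSpace ℝ (Fin 3)) L ∩
        ({y | ∀ σ ∈ Icc 0 S, ‖ODE.evolutionMap (fun _ : ℝ => selfSimilarTransport γ 0 V') 0 σ y‖ ≤ f σ} ∩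
          {y | ‖ODE.evolutionMap (fun _ : ℝ => selfSimilarTransport γ 0 V') 0 S y‖ ≤ d}) := by
    ext y; simp only [mem_setOf_eq, mem_inter_iff]
  rw [hset]
  exact measurableSet_ball.inter (h1.measurableSet.inter h2.measurableSet)

/-- ★ **NO FOCUSING (t59-NF, `NsregP2.R54.Trace.NoFocusingLaw ρ V` VERBATIM, every `ρ > −2`).**  Labels in `B_L` that stay in the `CL`-tube
up to the horizon `S` and sit at physical radius `≤ δ` at time `S` (`‖Ψ_S y‖ ≤ δe^{S/(2+ρ)}`) have volume `≤ vol B̄_δ`: the image of the label set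
under `Ψ_S` has volume `e^{3S/(2+ρ)}·vol` (Jacobian of the similarity flow where `V′ = V` is divergence-free) and lies in `B̄(0, δe^{S/(2+ρ)})`,
of volume `e^{3S/(2+ρ)}·vol B̄_δ`.  Pure incompressibility; no budget is used.
[nsreg-p2 R54 §C t59-NF; cite: ConstantinIgnatovaVicol2026Putative, §3.4.1 eq. (3.22)] -/
theorem noFocusingLaw {ρ : ℝ} (hρ : -2 < ρ) (V : EuclideanSpace ℝ (Fin 3) → EuclideanSpace ℝ (Fin 3)) :
    ∀ P : EuclideanSpace ℝ (Fin 3) → ℝ, IsSelfSimilarEulerProfile (1 / (2 + ρ)) 0 V P →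
    ∀ (C L S δ : ℝ) (V' : EuclideanSpace ℝ (Fin 3) → EuclideanSpace ℝ (Fin 3)) (K Rbig : ℝ),
      1 ≤ C → 1 ≤ L → 0 ≤ S → 0 < δ → ContDiff ℝ 2 V' →
      (∀ y, ‖fderiv ℝ V' y‖ ≤ K) → 2 * C * L * Real.exp (S / (2 + ρ)) < Rbig →
      (∀ w ∈ ball (0 : EuclideanSpace ℝ (Fin 3)) Rbig, V' w = V w) →
      volume {y ∈ ball (0 : EuclideanSpace ℝ (Fin 3)) L |
          (∀ σ ∈ Icc 0 S, ‖ODE.evolutionMap (fun _ : ℝ => selfSimilarTransport (1 / (2 + ρ)) (0 : EuclideanSpace ℝ (Fin 3)) V') 0 σ y‖ ≤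
              C * L * Real.exp (σ / (2 + ρ))) ∧
            ‖ODE.evolutionMap (fun _ : ℝ => selfSimilarTransport (1 / (2 + ρ)) (0 : EuclideanSpace ℝ (Fin 3)) V') 0 S y‖ ≤
              δ * Real.exp (S / (2 + ρ))} ≤
        volume (closedBall (0 : EuclideanSpace ℝ (Fin 3)) δ) := by
  intro P hprof C L S δ V' K Rbig hC hL hS hδ hV' hK hRbig hVV'
  have h2ρ : 0 < 2 + ρ := by linarith
  set γ : ℝ := 1 / (2 + ρ) with hγ
  set Φ := ODE.evolutionMap (fun _ : ℝ => selfSimilarTransport γ (0 : EuclideanSpace ℝ (Fin 3)) V') 0 with hΦ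
  set R : ℝ := C * L * Real.exp (S / (2 + ρ)) with hR
  set Y : Set (EuclideanSpace ℝ (Fin 3)) := {y ∈ ball (0 : EuclideanSpace ℝ (Fin 3)) L |
      (∀ σ ∈ Icc 0 S, ‖Φ σ y‖ ≤ C * L * Real.exp (σ / (2 + ρ))) ∧ ‖Φ S y‖ ≤ δ * Real.exp (S / (2 + ρ))} with hY
  -- measurability of the label set
  have hYm : MeasurableSet Y :=
    measurableSet_tubeLabels (γ := γ) hV' hK L S (δ * Real.exp (S / (2 + ρ))) (fun σ => C * L * Real.exp (σ / (2 + ρ)))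
  -- the orbits of `Y` stay in the closed ball of radius `R`
  have hstay : ∀ y ∈ Y, ∀ σ ∈ Icc 0 S, ‖Φ σ y‖ ≤ R := by
    intro y hy σ hσ
    refine (hy.2.1 σ hσ).trans ?_
    have hCL : 0 ≤ C * L := by positivity
    have hexp : Real.exp (σ / (2 + ρ)) ≤ Real.exp (S / (2 + ρ)) :=
      Real.exp_le_exp.2 (div_le_div_of_nonneg_right hσ.2 h2ρ.le)
    exact mul_le_mul_of_nonneg_left hexp hCL
  -- `V′` is divergence-free on that ball (it agrees with `V` on the open ball `ball 0 Rbig ⊇ closedBall 0 R`)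
  have hRbig : R < Rbig := by
    have hRpos : 0 ≤ R := by positivity
    linarith
  have hdiv : ∀ z : EuclideanSpace ℝ (Fin 3), ‖z‖ ≤ R → VectorCalculus.divergence V' z = 0 := by
    intro z hz
    have hzB : z ∈ ball (0 : EuclideanSpace ℝ (Fin 3)) Rbig := by
      rw [mem_ball_zero_iff]; exact lt_of_le_of_lt hz hRbig
    have hEq : V' =ᶠ[𝓝 z] V :=
      Filter.eventually_of_mem (isOpen_ball.mem_nhds hzB) fun w hw => hVV' w hw
    have hfd : fderiv ℝ V' z = fderiv ℝ V z := hEq.fderiv_eq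
    have h0 := hprof.divFree z
    unfold VectorCalculus.divergence at h0 ⊢
    rw [hfd]; exact h0
  -- Jacobian: `vol (Φ S '' Y) = e^{3γS} · vol Y`
  have himg := volume_image_flow_eq_exp_of_stay (γ := γ) hV' hK hS hdiv hYm hstay
  -- the image lies in the closed ball of radius `δ e^{S/(2+ρ)}`
  have hsub : Φ S '' Y ⊆ closedBall (0 : EuclideanSpace ℝ (Fin 3)) (Real.exp (S / (2 + ρ)) * δ) := by
    rintro _ ⟨y, hy, rfl⟩
    rw [mem_closedBall_zero_iff, mul_comm]
    exact hy.2.2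
  have hvol_ball : volume (closedBall (0 : EuclideanSpace ℝ (Fin 3)) (Real.exp (S / (2 + ρ)) * δ)) =
      ENNReal.ofReal (Real.exp (3 * γ * S)) * volume (closedBall (0 : EuclideanSpace ℝ (Fin 3)) δ) := by
    rw [Measure.addHaar_closedBall_mul_of_pos volume (0 : EuclideanSpace ℝ (Fin 3)) (Real.exp_pos _) δ,
      finrank_euclideanSpace, Fintype.card_fin]
    congr 2
    rw [← Real.exp_nat_mul]
    congr 1
    rw [hγ]; push_cast; field_simp
  have hle : ENNReal.ofReal (Real.exp (3 * γ * S)) * volume Y ≤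
      ENNReal.ofReal (Real.exp (3 * γ * S)) * volume (closedBall (0 : EuclideanSpace ℝ (Fin 3)) δ) := by
    rw [← himg, ← hvol_ball]
    exact measure_mono hsub
  have hpos : ENNReal.ofReal (Real.exp (3 * γ * S)) ≠ 0 := by
    rw [Ne, ENNReal.ofReal_eq_zero, not_le]; exact Real.exp_pos _
  exact (ENNReal.mul_le_mul_iff_right hpos ENNReal.ofReal_ne_top).1 hle

end Summit.NavierStokesRegularity.NavierStokesRegularity.Theorems.PowerGaugeEulerLiouville.Trace
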